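import Summits.AtomisticToContinuum.HydrodynamicLimit.Theses.LoschmidtIsentropicSelection
import Literature.Probability.Entropy.EntropyInequality

/-!
# Line `entropy-seam` on the crux `AutonomousClosure` (stmt-AtomisticToContinuum-13749) — registered skeleton

Crux-strategist skeleton for `Summit.AtomisticToContinuum.HydrodynamicLimit.Theses.LoschmidtIsentropicSelection.AutonomousClosure`
along the seam of the relative entropy method (Yau 1991; Olla–Varadhan–Yau 1993 §1; Kipnis–Landim 1999 Ch. 6 / App. 1 §8).
It is at the same time the TYPED SPLIT prepared for `route edit --split AutonomousClosure` (children `EntropicClosure` =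
stubs 1–3 composed, `LocalGibbsExpConcentration` = stubs 4–5 composed; the split glue `autonomousClosure_of_subs` below is
the file `Cruxes/AutonomousClosure/SplitGlue.lean`, repeated here — with the crux UNFOLDED in its conclusion — so that this skeleton is self-contained and `AutonomousClosure_of` is the only theorem concluding the crux by name).

STUBS (each a genuine lemma of the line; sizes in the card `Lines/entropy-seam.md`):
* `stub_hsLawWP` (provable now, M): the hard-sphere pressure law is `C^∞` on the dilute state space and Euler[p_hs] is
  locally classically solvable from smooth positive dilute data (tree: `hsEuler_localExistence_holds`,
  `HsEosLowDensity_holds`; bookkeeping between the eight clauses and `IsHardSphereEulerSolution`).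
* `stub_sliceRealisability` (statics, M/L): along a guarded classical hs-Euler solution started from local-Gibbs data in the
  LLN sense, every slice `(ρ_t, u_t, θ_t)` is realised (LLN at time `0`) by probability local Gibbs laws with some continuous
  positive activity `a_t` (inverse activity map at small packing + `∫ρ_t = ∫ρ_0 = 1`).
* `stub_entropyPropagation` (THE HEART, open): for every such realising activity, the specific relative entropy of the
  true time-`t` law w.r.t. the reference local Gibbs law vanishes, `klDiv((Φ_t)_* LG₀ ‖ LG(a_t,u_t,θ_t))/(N+1) → 0`
  (Yau's theorem for deterministic hard spheres; OVY 1993 Thm 2.1 prove it WITH weak noise).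
* `stub_densityLDP` (statics, L): exponential concentration of the DENSITY field of a dilute local Gibbs law around its
  LLN limit (large deviations by the canonical cluster expansion).
* `stub_maxwellianMarks` (statics, M): given exponential concentration of the density field for all continuous test
  functions, the momentum and energy fields concentrate exponentially (conditionally independent Maxwellian marks:
  Cramér–Chernoff / Bernstein).
COMPOSITION `AutonomousClosure_of : stub₁ → … → stub₅ → AutonomousClosure` — real proof: `entropicClosure_of`
(threshold `min`, `p̃ := hsPressure σ`, the bound predicate `IsSol` at `p̃ = hsPressure σ` IS `IsHardSphereEulerSolution`),
`localGibbsExpConcentration_of` (`C := max C₁ C₂`, monotonicity of `C ↦ C e^{-(N+1)/C}`), and the split glue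
`autonomousClosure_of_subs` (entropy inequality + `Measure.le_map_apply`).
-/

namespace Summit.AtomisticToContinuum.HydrodynamicLimit.Cruxes.AutonomousClosure.EntropySeam

open MeasureTheory Filter Set Topology
open scoped ENNReal

/-! ## Registered stubs -/

/-- Stub 1 (provable now): smoothness of `hsPressure σ` on the dilute state space and local classical solvability of the
hard-sphere Euler system from smooth positive dilute data, with ONE threshold `η₁` before `∀ σ`
(Dafermos 2005 Thm 5.1.1 / Kato 1975 / Majda 1984 Thm 2.1 as vendored and PROVED in tree: `hsEuler_localExistence_holds`,
with the equation-of-state input `HsEosLowDensity_holds`). [cite: Dafermos2005, Thm 5.1.1] -/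
theorem stub_hsLawWP :
    ∃ η₁ : ℝ, 0 < η₁ ∧ ∀ σ : ℝ, 0 < σ → ContDiffOn ℝ (⊤ : ℕ∞) (fun q : ℝ × ℝ => Literature.MathematicalPhysics.KineticTheory.hsPressure σ q.1 q.2) {q : ℝ × ℝ | 0 < q.1 ∧ q.1 * σ ^ 3 < η₁ ∧ 0 < q.2} ∧ ∀ (ρ₀ θ₀ : Literature.MathematicalPhysics.KineticTheory.T3 → ℝ) (u₀ : Literature.MathematicalPhysics.KineticTheory.T3 → Literature.MathematicalPhysics.KineticTheory.V3), Literature.Analysis.FunctionSpaces.Torus.IsSmooth ρ₀ → Literature.Analysis.FunctionSpaces.Torus.IsSmooth θ₀ → Literature.Analysis.FunctionSpaces.Torus.IsSmooth u₀ → (∀ x, 0 < ρ₀ x) → (∀ x, 0 < θ₀ x) → (∀ x, ρ₀ x * σ ^ 3 < η₁) → ∃ T : ℝ, 0 < T ∧ ∃ (ρ θ : ℝ → Literature.MathematicalPhysics.KineticTheory.T3 → ℝ) (u : ℝ → Literature.MathematicalPhysics.KineticTheory.T3 → Literature.MathematicalPhysics.KineticTheory.V3), Literature.MathematicalPhysics.KineticTheory.IsHardSphereEulerSolution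 σ T ρ u θ ∧ ρ 0 = ρ₀ ∧ u 0 = u₀ ∧ θ 0 = θ₀ := by
  sorry

/-- Stub 2 (statics): realisability of the slices of a guarded classical hs-Euler solution started in local equilibrium by
probability local Gibbs laws with a continuous positive activity (inverse of the activity → density map at small packing,
Ruelle 1969 §4 / Lebowitz–Penrose 1964; mass conservation gives `∫ρ_t = 1`). [cite: Ruelle1969, §4.2] -/
theorem stub_sliceRealisability :
    ∃ η₂ : ℝ, 0 < η₂ ∧ ∀ σ : ℝ, 0 < σ → ∀ (a₀ θ₀ : Literature.MathematicalPhysics.KineticTheory.T3 → ℝ) (u₀ : Literature.MathematicalPhysics.KineticTheory.T3 → Literature.MathematicalPhysics.KineticTheory.V3), Continuous a₀ → Continuous θ₀ → Continuous u₀ → (∀ x, 0 < a₀ x) → (∀ x, 0 < θ₀ x) → ∀ (T : ℝ) (ρ θ : ℝ → Literature.MathematicalPhysics.KineticTheory.T3 → ℝ) (u : ℝ → Literature.MathematicalPhysics.KineticTheory.T3 → Literature.MathematicalPhysics.KineticTheory.V3), Literature.MathematicalPhysics.KineticTheory.IsHardSphereEulerSolution σ T ρ u θ → (∀ t ∈ Set.Ico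 0 T, ∀ x, ρ t x * σ ^ 3 < η₂) → ∀ Φ : (N : ℕ) → Literature.Analysis.FluidPDE.HardSphereFlow (Literature.Analysis.FluidPDE.Torus.geometry (Fin 3)) (Literature.MathematicalPhysics.KineticTheory.hsDiameter σ N) (N + 1), (∀ N, MeasureTheory.IsProbabilityMeasure (Literature.MathematicalPhysics.KineticTheory.localGibbsLaw σ a₀ u₀ θ₀ N (Φ N))) → Literature.MathematicalPhysics.KineticTheory.TendstoHydroFieldsAt (fun N => Literature.MathematicalPhysics.KineticTheory.localGibbsLaw σ a₀ u₀ θ₀ N (Φ N)) Φ ρ u θ 0 → ∀ t ∈ Set.Ico 0 T, ∃ a : Literature.MathematicalPhysics.KineticTheory.T3 → ℝ, Continuous a ∧ (∀ x, 0 < a x) ∧ (∀ N, MeasureTheory.IsProbabilityMeasure (Literature.MathematicalPhysics.KineticTheory.localGibbsLaw σ a (u t) (θ t) N (Φ N))) ∧ Literature.MathematicalPhysics.KineticTheory.TendstoHydroFieldsAt (fun N => Literature.MathematicalPhysics.KineticTheory.localGibbsLaw σ a (u t) (θ t) N (Φ N)) Φ (fun _ => ρ t) (fun _ => u t) (fun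 _ => θ t) 0 := by
  sorry

/-- Stub 3 (the heart; open): Yau's relative-entropy propagation for DETERMINISTIC hard spheres at small packing — for
every realising reference activity the specific relative entropy of the true time-`t` law with respect to the local Gibbs
law built on the Euler slice vanishes (Yau 1991; Olla–Varadhan–Yau 1993 Thm 2.1 WITH weak noise; here without).
[cite: OllaVaradhanYau1993, Thm 2.1] -/
theorem stub_entropyPropagation :
    ∃ η₃ : ℝ, 0 < η₃ ∧ ∀ σ : ℝ, 0 < σ → ∀ (a₀ θ₀ : Literature.MathematicalPhysics.KineticTheory.T3 → ℝ) (u₀ : Literature.MathematicalPhysics.KineticTheory.T3 → Literature.MathematicalPhysics.KineticTheory.V3), Continuous a₀ → Continuous θ₀ → Continuous u₀ → (∀ x, 0 < a₀ x) → (∀ x, 0 < θ₀ x) → ∀ (T : ℝ) (ρ θ : ℝ → Literature.MathematicalPhysics.KineticTheory.T3 → ℝ) (u : ℝ → Literature.MathematicalPhysics.KineticTheory.T3 → Literature.MathematicalPhysics.KineticTheory.V3), Literature.MathematicalPhysics.KineticTheory.IsHardSphereEulerSolution σ T ρ u θ → (∀ t ∈ Set.Ico 0 T, ∀ x, ρ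 t x * σ ^ 3 < η₃) → ∀ Φ : (N : ℕ) → Literature.Analysis.FluidPDE.HardSphereFlow (Literature.Analysis.FluidPDE.Torus.geometry (Fin 3)) (Literature.MathematicalPhysics.KineticTheory.hsDiameter σ N) (N + 1), (∀ N, MeasureTheory.IsProbabilityMeasure (Literature.MathematicalPhysics.KineticTheory.localGibbsLaw σ a₀ u₀ θ₀ N (Φ N))) → Literature.MathematicalPhysics.KineticTheory.TendstoHydroFieldsAt (fun N => Literature.MathematicalPhysics.KineticTheory.localGibbsLaw σ a₀ u₀ θ₀ N (Φ N)) Φ ρ u θ 0 → ∀ t ∈ Set.Ico 0 T, ∀ a : Literature.MathematicalPhysics.KineticTheory.T3 → ℝ, Continuous a → (∀ x, 0 < a x) → (∀ N, MeasureTheory.IsProbabilityMeasure (Literature.MathematicalPhysics.KineticTheory.localGibbsLaw σ a (u t) (θ t) N (Φ N))) → Literature.MathematicalPhysics.KineticTheory.TendstoHydroFieldsAt (fun N => Literature.MathematicalPhysics.KineticTheory.localGibbsLaw σ a (u t) (θ t) N (Φ N)) Φ (fun _ => ρ t) (fun _ => u t) (fun _ => θ t) 0 → Filter.Tendsto (fun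 N : ℕ => InformationTheory.klDiv ((Φ N).lawAt (Literature.MathematicalPhysics.KineticTheory.localGibbsLaw σ a₀ u₀ θ₀ N (Φ N)) t) (Literature.MathematicalPhysics.KineticTheory.localGibbsLaw σ a (u t) (θ t) N (Φ N)) / ((N : ENNReal) + 1)) Filter.atTop (nhds 0) := by
  sorry

/-- Stub 4 (statics): exponential concentration (large-deviation upper bound) of the empirical DENSITY field of a dilute
local Gibbs law around its law-of-large-numbers limit (canonical cluster expansion of the tilted partition function,
Ruelle 1969 Ch. 4; Georgii–Zessin 1993 for the grand-canonical LDP). [cite: GeorgiiZessin1993, Thm 3.1] -/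
theorem stub_densityLDP :
    ∃ η₀ : ℝ, 0 < η₀ ∧ ∀ σ : ℝ, 0 < σ → ∀ (a θ ρV : Literature.MathematicalPhysics.KineticTheory.T3 → ℝ) (u : Literature.MathematicalPhysics.KineticTheory.T3 → Literature.MathematicalPhysics.KineticTheory.V3), Continuous a → Continuous θ → Continuous ρV → Continuous u → (∀ x, 0 < a x) → (∀ x, 0 < θ x) → (∀ x, 0 < ρV x) → (∀ x, ρV x * σ ^ 3 < η₀) → ∀ Φ : (N : ℕ) → Literature.Analysis.FluidPDE.HardSphereFlow (Literature.Analysis.FluidPDE.Torus.geometry (Fin 3)) (Literature.MathematicalPhysics.KineticTheory.hsDiameter σ N) (N + 1), (∀ N, MeasureTheory.IsProbabilityMeasure (Literature.MathematicalPhysics.KineticTheory.localGibbsLaw σ a u θ N (Φ N))) → Literature.MathematicalPhysics.KineticTheory.TendstoHydroFieldsAt (fun N => Literature.MathematicalPhysics.KineticTheory.localGibbsLaw σ a u θ N (Φ N)) Φ (fun _ => ρV) (fun _ => u) (fun _ => θ) 0 → ∀ χ : Literature.MathematicalPhysics.KineticTheory.T3 → ℝ, Continuous χ → ∀ δ : ℝ,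 0 < δ → ∃ C : ℝ, 0 < C ∧ ∀ N : ℕ, Literature.MathematicalPhysics.KineticTheory.localGibbsLaw σ a u θ N (Φ N) {z | δ < |Literature.MathematicalPhysics.KineticTheory.empiricalDensityField z χ - ∫ x, χ x * ρV x|} ≤ ENNReal.ofReal (C * Real.exp (-(C⁻¹ * (N + 1)))) := by
  sorry

/-- Stub 5 (statics): conditionally on the positions the velocities of a local Gibbs law are independent Maxwellians
`M_{u(x_i), θ(x_i)}`, so exponential concentration of the density field (for all continuous test functions) upgrades to
exponential concentration of the momentum and energy fields (Cramér–Chernoff / Bernstein bounds; Kipnis–Landim 1999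
App. 1). [cite: KipnisLandim1999, Appendix 1 Prop. 8.2] -/
theorem stub_maxwellianMarks :
    ∀ σ : ℝ, 0 < σ → ∀ (a θ ρV : Literature.MathematicalPhysics.KineticTheory.T3 → ℝ) (u : Literature.MathematicalPhysics.KineticTheory.T3 → Literature.MathematicalPhysics.KineticTheory.V3), Continuous a → Continuous θ → Continuous ρV → Continuous u → (∀ x, 0 < a x) → (∀ x, 0 < θ x) → ∀ Φ : (N : ℕ) → Literature.Analysis.FluidPDE.HardSphereFlow (Literature.Analysis.FluidPDE.Torus.geometry (Fin 3)) (Literature.MathematicalPhysics.KineticTheory.hsDiameter σ N) (N + 1), (∀ N, MeasureTheory.IsProbabilityMeasure (Literature.MathematicalPhysics.KineticTheory.localGibbsLaw σ a u θ N (Φ N))) → (∀ χ : Literature.MathematicalPhysics.KineticTheory.T3 → ℝ, Continuous χ → ∀ δ : ℝ, 0 < δ → ∃ C : ℝ, 0 < C ∧ ∀ N : ℕ, Literature.MathematicalPhysics.KineticTheory.localGibbsLaw σ a u θ N (Φ N) {z | δ < |Literature.MathematicalPhysics.KineticTheory.empiricalDensityField z χ - ∫ x, χ x * ρV x|} ≤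 ENNReal.ofReal (C * Real.exp (-(C⁻¹ * (N + 1))))) → ∀ χ : Literature.MathematicalPhysics.KineticTheory.T3 → ℝ, Continuous χ → ∀ δ : ℝ, 0 < δ → ∃ C : ℝ, 0 < C ∧ ∀ N : ℕ, Literature.MathematicalPhysics.KineticTheory.localGibbsLaw σ a u θ N (Φ N) {z | δ < ‖Literature.MathematicalPhysics.KineticTheory.empiricalMomentumField z χ - ∫ x, (χ x * ρV x) • u x‖} ≤ ENNReal.ofReal (C * Real.exp (-(C⁻¹ * (N + 1)))) ∧ Literature.MathematicalPhysics.KineticTheory.localGibbsLaw σ a u θ N (Φ N) {z | δ < |Literature.MathematicalPhysics.KineticTheory.empiricalEnergyField z χ - ∫ x, χ x * Literature.MathematicalPhysics.KineticTheory.totalEnergyDensity (ρV x) (u x) (θ x)|} ≤ ENNReal.ofReal (C * Real.exp (-(C⁻¹ * (N + 1)))) := by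
  sorry

/-! ## The split glue (verbatim `Cruxes/AutonomousClosure/SplitGlue.lean`) -/

/-- **Entropy inequality, thresholded form.** For probability measures `μ`, `ν` with finite relative
entropy `H(μ | ν) = klDiv μ ν` and any set `A` (measurable or not) with `ν A ≤ q`, `0 < q`:
`μ A ≤ (log 2 + H(μ | ν)) / log (1 + q⁻¹)` — Kipnis–Landim 1999, App. 1, Prop. 8.2 applied to the
measurable hull of `A`, with the monotonicity of `r ↦ log (1 + r⁻¹)`; the case `ν A = 0` is absolute
continuity. [cite: KipnisLandim1999, Appendix 1 Prop. 8.2] -/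
theorem measureReal_le_entropy_bound {E : Type} [MeasurableSpace E] (μ ν : Measure E)
    [IsProbabilityMeasure μ] [IsProbabilityMeasure ν] (A : Set E) {q : ℝ} (hq : 0 < q)
    (hνA : ν A ≤ ENNReal.ofReal q) (hH : InformationTheory.klDiv μ ν ≠ ⊤) :
    (μ A).toReal ≤
      (Real.log 2 + (InformationTheory.klDiv μ ν).toReal) / Real.log (1 + q⁻¹) := by
  have hμν : μ ≪ ν := (InformationTheory.klDiv_ne_top_iff.mp hH).1
  have hnum : 0 ≤ Real.log 2 + (InformationTheory.klDiv μ ν).toReal :=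
    add_nonneg (Real.log_nonneg (by norm_num)) ENNReal.toReal_nonneg
  have hden : 0 < Real.log (1 + q⁻¹) := Real.log_pos (by have := inv_pos.mpr hq; linarith)
  set B : Set E := toMeasurable ν A with hB_def
  have hAB : A ⊆ B := subset_toMeasurable ν A
  have hBmeas : MeasurableSet B := measurableSet_toMeasurable ν A
  have hνB : ν B = ν A := measure_toMeasurable A
  have hμAB : (μ A).toReal ≤ (μ B).toReal :=
    ENNReal.toReal_mono (measure_ne_top μ B) (measure_mono hAB)
  by_cases hB0 : ν B = 0
  · have hμB : μ B = 0 := hμν hB0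
    rw [hμB, ENNReal.toReal_zero] at hμAB
    exact hμAB.trans (div_nonneg hnum hden.le)
  · have hKL := Literature.Probability.Entropy.KipnisLandim1999_A1_8_2_holds E μ ν B hBmeas hB0 hH
    have hνBq : (ν B).toReal ≤ q := by
      rw [hνB]
      exact ENNReal.toReal_le_of_le_ofReal hq.le hνA
    have hνBpos : 0 < (ν B).toReal := ENNReal.toReal_pos hB0 (measure_ne_top ν B)
    have hlog : Real.log (1 + q⁻¹) ≤ Real.log (1 + (ν B).toReal⁻¹) := by
      apply Real.log_le_log (by have := inv_pos.mpr hq; linarith)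
      have : q⁻¹ ≤ (ν B).toReal⁻¹ := by
        rw [inv_le_inv₀ hq hνBpos]; exact hνBq
      linarith
    calc (μ A).toReal ≤ (μ B).toReal := hμAB
      _ ≤ (Real.log 2 + (InformationTheory.klDiv μ ν).toReal) / Real.log (1 + (ν B).toReal⁻¹) := hKL
      _ ≤ (Real.log 2 + (InformationTheory.klDiv μ ν).toReal) / Real.log (1 + q⁻¹) :=
          div_le_div_of_nonneg_left hnum hden hlog

/-- **From vanishing specific relative entropy and exponential concentration to vanishing
probabilities** (the passage at the end of the relative entropy method; Kipnis–Landim 1999, Ch. 6 /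
App. 1 Prop. 8.2; Yau 1991; Olla–Varadhan–Yau 1993, §1): if `H(μ_N | ν_N)/(N+1) → 0` and
`ν_N(A_N) ≤ C e^{-(N+1)/C}`, then `μ_N(A_N) → 0`. [cite: KipnisLandim1999, Appendix 1 Prop. 8.2] -/
theorem tendsto_measure_of_klDiv_of_expConcentration {E : ℕ → Type} [∀ N, MeasurableSpace (E N)]
    (μ ν : ∀ N, Measure (E N)) (hμ : ∀ N, IsProbabilityMeasure (μ N))
    (hν : ∀ N, IsProbabilityMeasure (ν N)) (A : ∀ N, Set (E N))
    (hH : Tendsto (fun N : ℕ => InformationTheory.klDiv (μ N) (ν N) / ((N : ℝ≥0∞) + 1)) atTop (𝓝 0))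
    {C : ℝ} (hC : 0 < C)
    (hA : ∀ N : ℕ, ν N (A N) ≤ ENNReal.ofReal (C * Real.exp (-(C⁻¹ * (N + 1))))) :
    Tendsto (fun N : ℕ => μ N (A N)) atTop (𝓝 0) := by
  rw [ENNReal.tendsto_nhds_zero]
  intro ε hε
  -- reduce to a real target `e > 0`
  by_cases hεtop : ε = ⊤
  · exact Eventually.of_forall fun N => hεtop ▸ le_top
  set e : ℝ := ε.toReal with he_def
  have he : 0 < e := ENNReal.toReal_pos hε.ne' hεtop
  have hεe : ENNReal.ofReal e = ε := ENNReal.ofReal_toReal hεtop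
  -- entropy budget: eventually `klDiv ≤ (e/(4C)) (N+1)`
  have hbudget : ∀ᶠ N : ℕ in atTop,
      InformationTheory.klDiv (μ N) (ν N) ≤ ENNReal.ofReal (e / (4 * C)) * ((N : ℝ≥0∞) + 1) := by
    have h1 : (0 : ℝ≥0∞) < ENNReal.ofReal (e / (4 * C)) := by
      rw [ENNReal.ofReal_pos]; positivity
    filter_upwards [ENNReal.tendsto_nhds_zero.mp hH _ h1] with N hN
    have hN1 : ((N : ℝ≥0∞) + 1) ≠ 0 := by positivity
    have hN2 : ((N : ℝ≥0∞) + 1) ≠ ⊤ := by simp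
    rwa [ENNReal.div_le_iff hN1 hN2] at hN
  -- time budget: `N + 1 ≥ max (2 C log C) (8 C log 2 / e)`
  have hlarge : ∀ᶠ N : ℕ in atTop, 2 * C * Real.log C ≤ (N : ℝ) + 1 ∧ 8 * C * Real.log 2 / e ≤ (N : ℝ) + 1 := by
    obtain ⟨N₀, hN₀⟩ := exists_nat_ge (max (2 * C * Real.log C) (8 * C * Real.log 2 / e))
    filter_upwards [eventually_ge_atTop N₀] with N hN
    have hN' : (N₀ : ℝ) ≤ (N : ℝ) + 1 := by
      have : (N₀ : ℝ) ≤ N := by exact_mod_cast hN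
      linarith
    exact ⟨(le_max_left _ _).trans (hN₀.trans hN'), (le_max_right _ _).trans (hN₀.trans hN')⟩
  filter_upwards [hbudget, hlarge] with N hN hNl
  haveI := hμ N
  haveI := hν N
  have hn : (0 : ℝ) < (N : ℝ) + 1 := by positivity
  -- finiteness of the entropy and its real bound
  have hHtop : InformationTheory.klDiv (μ N) (ν N) ≠ ⊤ := by
    refine ne_top_of_le_ne_top ?_ hN
    exact ENNReal.mul_ne_top ENNReal.ofReal_ne_top (by simp)
  have hHreal : (InformationTheory.klDiv (μ N) (ν N)).toReal ≤ e / (4 * C) * ((N : ℝ) + 1) := by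
    have := ENNReal.toReal_mono (ENNReal.mul_ne_top ENNReal.ofReal_ne_top (by simp)) hN
    have hcast : ((N : ℝ≥0∞) + 1).toReal = (N : ℝ) + 1 := by
      rw [← Nat.cast_succ, ENNReal.toReal_natCast, Nat.cast_succ]
    rwa [ENNReal.toReal_mul, ENNReal.toReal_ofReal (by positivity), hcast] at this
  -- the thresholded entropy inequality with `q = C e^{-(N+1)/C}`
  set q : ℝ := C * Real.exp (-(C⁻¹ * (N + 1))) with hq_def
  have hq : 0 < q := by positivity
  have hbound := measureReal_le_entropy_bound (μ N) (ν N) (A N) hq (hA N) hHtop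
  -- `log (1 + q⁻¹) ≥ log q⁻¹ = (N+1)/C - log C ≥ (N+1)/(2C)`
  have hlogq : Real.log (1 + q⁻¹) ≥ ((N : ℝ) + 1) / (2 * C) := by
    have h1 : Real.log q⁻¹ ≤ Real.log (1 + q⁻¹) :=
      Real.log_le_log (inv_pos.mpr hq) (by linarith)
    have h2 : Real.log q⁻¹ = C⁻¹ * ((N : ℝ) + 1) - Real.log C := by
      rw [Real.log_inv, hq_def, Real.log_mul hC.ne' (Real.exp_pos _).ne', Real.log_exp]
      ring
    have h3 : C⁻¹ * ((N : ℝ) + 1) - Real.log C ≥ ((N : ℝ) + 1) / (2 * C) := by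
      rw [ge_iff_le, div_le_iff₀ (by positivity)]
      have : Real.log C * (2 * C) ≤ (N + 1) := by nlinarith [hNl.1]
      field_simp
      nlinarith [hNl.1, hC]
    linarith
  have hden : (0 : ℝ) < ((N : ℝ) + 1) / (2 * C) := by positivity
  have hnum : 0 ≤ Real.log 2 + (InformationTheory.klDiv (μ N) (ν N)).toReal :=
    add_nonneg (Real.log_nonneg (by norm_num)) ENNReal.toReal_nonneg
  have hfinal : ((μ N) (A N)).toReal ≤ e := by
    have hH' : Real.log 2 + (InformationTheory.klDiv (μ N) (ν N)).toReal ≤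
        Real.log 2 + e / (4 * C) * ((N : ℝ) + 1) := by linarith
    have step1 : ((μ N) (A N)).toReal ≤
        (Real.log 2 + e / (4 * C) * ((N : ℝ) + 1)) / (((N : ℝ) + 1) / (2 * C)) :=
      hbound.trans ((div_le_div_of_nonneg_left hnum hden hlogq).trans
        (div_le_div_of_nonneg_right hH' hden.le))
    have step2 : (Real.log 2 + e / (4 * C) * ((N : ℝ) + 1)) / (((N : ℝ) + 1) / (2 * C)) =
        2 * C * Real.log 2 / ((N : ℝ) + 1) + e / 2 := by
      field_simp
      ring
    have step3 : 2 * C * Real.log 2 / ((N : ℝ) + 1) ≤ e / 2 := by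
      rw [div_le_iff₀ hn]
      have h8 := hNl.2
      rw [div_le_iff₀ he] at h8
      nlinarith [he, hn]
    linarith [step1, step2, step3]
  rw [← hεe]
  exact (ENNReal.le_ofReal_iff_toReal_le (measure_ne_top _ _) he.le).mpr hfinal

/-- **The typed split of `AutonomousClosure`** (crux-strategist, stmt-AtomisticToContinuum-13749):
`EntropicClosure → LocalGibbsExpConcentration → AutonomousClosure`, the two hypotheses being VERBATIM the statements
filed as the route's new leaves (arrow form).  Proof: thresholds `min η₁ η₂`; smoothness domain and well-posedness by
monotonicity in the threshold; for the convergence clause at time `t`, take the reference activity `a_t` from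
`EntropicClosure`, feed its law of large numbers and the continuity/positivity of the slices `(ρ_t, u_t, θ_t)` (from the
defining `↔` of the bound predicate `IsSol`) to `LocalGibbsExpConcentration`, and conclude with
`tendsto_measure_of_klDiv_of_expConcentration` and `Measure.le_map_apply` along `Φ_t`.
[cite: KipnisLandim1999, Appendix 1 Prop. 8.2] -/
theorem autonomousClosure_of_subs :
    (∀ IsSol : (ℝ → ℝ → ℝ) → ℝ → (ℝ → Literature.MathematicalPhysics.KineticTheory.T3 → ℝ) → (ℝ → Literature.MathematicalPhysics.KineticTheory.T3 → Literature.MathematicalPhysics.KineticTheory.V3) → (ℝ → Literature.MathematicalPhysics.KineticTheory.T3 → ℝ) → Prop, (∀ p T ρ u θ, IsSol p T ρ u θ ↔ (Literature.Analysis.FunctionSpaces.Torus.IsSmoothSpaceTimeOn (Set.Ico 0 T) ρ ∧ Literature.Analysis.FunctionSpaces.Torus.IsSmoothSpaceTimeOn (Set.Ico 0 T) u ∧ Literature.Analysis.FunctionSpaces.Torus.IsSmoothSpaceTimeOn (Set.Ico 0 T) θ ∧ (∀ t ∈ Set.Ico 0 T, ∀ x, 0 < ρ t x) ∧ (∀ t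 ∈ Set.Ico 0 T, ∀ x, 0 < θ t x) ∧ (∀ t ∈ Set.Ico 0 T, ∀ x, Literature.Analysis.FunctionSpaces.Torus.timeDerivWithin (Set.Ico 0 T) ρ t x + Literature.Analysis.FunctionSpaces.Torus.divergence (fun y => ρ t y • u t y) x = 0) ∧ (∀ t ∈ Set.Ico 0 T, ∀ x, Literature.Analysis.FunctionSpaces.Torus.timeDerivWithin (Set.Ico 0 T) (fun s y => ρ s y • u s y) t x + (∑ i, Literature.Analysis.FunctionSpaces.Torus.partialDeriv i (fun y => (ρ t y * u t y i) • u t y) x) + Literature.Analysis.FunctionSpaces.Torus.gradient (fun y => p (ρ t y) (θ t y)) x = 0) ∧ (∀ t ∈ Set.Ico 0 T, ∀ x, Literature.Analysis.FunctionSpaces.Torus.timeDerivWithin (Set.Ico 0 T) (fun s y => Literature.MathematicalPhysics.KineticTheory.totalEnergyDensity (ρ s y) (u s y) (θ s y)) t x + Literature.Analysis.FunctionSpaces.Torus.divergence (fun y => (Literature.MathematicalPhysics.KineticTheory.totalEnergyDensity (ρ t y) (u t y) (θ t y) + p (ρ t y) (θ t y)) • u t y) x = 0))) → ∃ η₀ :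 ℝ, 0 < η₀ ∧ ∀ σ : ℝ, 0 < σ → ∃ p : ℝ → ℝ → ℝ, ContDiffOn ℝ (⊤ : ℕ∞) (fun q : ℝ × ℝ => p q.1 q.2) {q : ℝ × ℝ | 0 < q.1 ∧ q.1 * σ ^ 3 < η₀ ∧ 0 < q.2} ∧ (∀ (ρ₀ θ₀ : Literature.MathematicalPhysics.KineticTheory.T3 → ℝ) (u₀ : Literature.MathematicalPhysics.KineticTheory.T3 → Literature.MathematicalPhysics.KineticTheory.V3), Literature.Analysis.FunctionSpaces.Torus.IsSmooth ρ₀ → Literature.Analysis.FunctionSpaces.Torus.IsSmooth θ₀ → Literature.Analysis.FunctionSpaces.Torus.IsSmooth u₀ → (∀ x, 0 < ρ₀ x) → (∀ x, 0 < θ₀ x) → (∀ x, ρ₀ x * σ ^ 3 < η₀) → ∃ T : ℝ, 0 < T ∧ ∃ (ρ θ : ℝ → Literature.MathematicalPhysics.KineticTheory.T3 → ℝ) (u : ℝ → Literature.MathematicalPhysics.KineticTheory.T3 → Literature.MathematicalPhysics.KineticTheory.V3), IsSol p T ρ u θ ∧ ρ 0 = ρ₀ ∧ u 0 = u₀ ∧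 θ 0 = θ₀) ∧ ∀ (a₀ θ₀ : Literature.MathematicalPhysics.KineticTheory.T3 → ℝ) (u₀ : Literature.MathematicalPhysics.KineticTheory.T3 → Literature.MathematicalPhysics.KineticTheory.V3), Continuous a₀ → Continuous θ₀ → Continuous u₀ → (∀ x, 0 < a₀ x) → (∀ x, 0 < θ₀ x) → ∀ (T : ℝ) (ρ θ : ℝ → Literature.MathematicalPhysics.KineticTheory.T3 → ℝ) (u : ℝ → Literature.MathematicalPhysics.KineticTheory.T3 → Literature.MathematicalPhysics.KineticTheory.V3), IsSol p T ρ u θ → (∀ t ∈ Set.Ico 0 T, ∀ x, ρ t x * σ ^ 3 < η₀) → ∀ Φ : (N : ℕ) → Literature.Analysis.FluidPDE.HardSphereFlow (Literature.Analysis.FluidPDE.Torus.geometry (Fin 3)) (Literature.MathematicalPhysics.KineticTheory.hsDiameter σ N) (N + 1), (∀ N, MeasureTheory.IsProbabilityMeasure (Literature.MathematicalPhysics.KineticTheory.localGibbsLaw σ a₀ u₀ θ₀ N (Φ N))) → Literature.MathematicalPhysics.KineticTheory.TendstoHydroFieldsAt (fun N => Literature.MathematicalPhysics.KineticTheory.localGibbsLaw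 σ a₀ u₀ θ₀ N (Φ N)) Φ ρ u θ 0 → ∀ t ∈ Set.Ico 0 T, ∃ a : Literature.MathematicalPhysics.KineticTheory.T3 → ℝ, Continuous a ∧ (∀ x, 0 < a x) ∧ (∀ N, MeasureTheory.IsProbabilityMeasure (Literature.MathematicalPhysics.KineticTheory.localGibbsLaw σ a (u t) (θ t) N (Φ N))) ∧ Literature.MathematicalPhysics.KineticTheory.TendstoHydroFieldsAt (fun N => Literature.MathematicalPhysics.KineticTheory.localGibbsLaw σ a (u t) (θ t) N (Φ N)) Φ (fun _ => ρ t) (fun _ => u t) (fun _ => θ t) 0 ∧ Filter.Tendsto (fun N : ℕ => InformationTheory.klDiv ((Φ N).lawAt (Literature.MathematicalPhysics.KineticTheory.localGibbsLaw σ a₀ u₀ θ₀ N (Φ N)) t) (Literature.MathematicalPhysics.KineticTheory.localGibbsLaw σ a (u t) (θ t) N (Φ N)) / ((N : ENNReal) + 1)) Filter.atTop (nhds 0)) →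
    (∃ η₀ : ℝ, 0 < η₀ ∧ ∀ σ : ℝ, 0 < σ → ∀ (a θ ρV : Literature.MathematicalPhysics.KineticTheory.T3 → ℝ) (u : Literature.MathematicalPhysics.KineticTheory.T3 → Literature.MathematicalPhysics.KineticTheory.V3), Continuous a → Continuous θ → Continuous ρV → Continuous u → (∀ x, 0 < a x) → (∀ x, 0 < θ x) → (∀ x, 0 < ρV x) → (∀ x, ρV x * σ ^ 3 < η₀) → ∀ Φ : (N : ℕ) → Literature.Analysis.FluidPDE.HardSphereFlow (Literature.Analysis.FluidPDE.Torus.geometry (Fin 3)) (Literature.MathematicalPhysics.KineticTheory.hsDiameter σ N) (N + 1), (∀ N, MeasureTheory.IsProbabilityMeasure (Literature.MathematicalPhysics.KineticTheory.localGibbsLaw σ a u θ N (Φ N))) → Literature.MathematicalPhysics.KineticTheory.TendstoHydroFieldsAt (fun N => Literature.MathematicalPhysics.KineticTheory.localGibbsLaw σ a u θ N (Φ N)) Φ (fun _ => ρV) (fun _ => u) (fun _ => θ) 0 → ∀ χ : Literature.MathematicalPhysics.KineticTheory.T3 → ℝ, Continuous χ → ∀ δ : ℝ, 0 < δ → ∃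 C : ℝ, 0 < C ∧ ∀ N : ℕ, Literature.MathematicalPhysics.KineticTheory.localGibbsLaw σ a u θ N (Φ N) {z | δ < |Literature.MathematicalPhysics.KineticTheory.empiricalDensityField z χ - ∫ x, χ x * ρV x|} ≤ ENNReal.ofReal (C * Real.exp (-(C⁻¹ * (N + 1)))) ∧ Literature.MathematicalPhysics.KineticTheory.localGibbsLaw σ a u θ N (Φ N) {z | δ < ‖Literature.MathematicalPhysics.KineticTheory.empiricalMomentumField z χ - ∫ x, (χ x * ρV x) • u x‖} ≤ ENNReal.ofReal (C * Real.exp (-(C⁻¹ * (N + 1)))) ∧ Literature.MathematicalPhysics.KineticTheory.localGibbsLaw σ a u θ N (Φ N) {z | δ < |Literature.MathematicalPhysics.KineticTheory.empiricalEnergyField z χ - ∫ x, χ x * Literature.MathematicalPhysics.KineticTheory.totalEnergyDensity (ρV x) (u x) (θ x)|} ≤ ENNReal.ofReal (C * Real.exp (-(C⁻¹ * (N + 1))))) →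
    (∀ IsSol : (ℝ → ℝ → ℝ) → ℝ → (ℝ → Literature.MathematicalPhysics.KineticTheory.T3 → ℝ) → (ℝ → Literature.MathematicalPhysics.KineticTheory.T3 → Literature.MathematicalPhysics.KineticTheory.V3) → (ℝ → Literature.MathematicalPhysics.KineticTheory.T3 → ℝ) → Prop, (∀ p T ρ u θ, IsSol p T ρ u θ ↔ (Literature.Analysis.FunctionSpaces.Torus.IsSmoothSpaceTimeOn (Set.Ico 0 T) ρ ∧ Literature.Analysis.FunctionSpaces.Torus.IsSmoothSpaceTimeOn (Set.Ico 0 T) u ∧ Literature.Analysis.FunctionSpaces.Torus.IsSmoothSpaceTimeOn (Set.Ico 0 T) θ ∧ (∀ t ∈ Set.Ico 0 T, ∀ x, 0 < ρ t x) ∧ (∀ t ∈ Set.Ico 0 T, ∀ x, 0 < θ t x) ∧ (∀ t ∈ Set.Ico 0 T, ∀ x, Literature.Analysis.FunctionSpaces.Torus.timeDerivWithin (Set.Ico 0 T) ρ t x + Literature.Analysis.FunctionSpaces.Torus.divergence (fun y => ρ t y • u t y) x = 0) ∧ (∀ t ∈ Set.Ico 0 T, ∀ x, Literature.Analysis.FunctionSpaces.Torus.timeDerivWithin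 (Set.Ico 0 T) (fun s y => ρ s y • u s y) t x + (∑ i, Literature.Analysis.FunctionSpaces.Torus.partialDeriv i (fun y => (ρ t y * u t y i) • u t y) x) + Literature.Analysis.FunctionSpaces.Torus.gradient (fun y => p (ρ t y) (θ t y)) x = 0) ∧ (∀ t ∈ Set.Ico 0 T, ∀ x, Literature.Analysis.FunctionSpaces.Torus.timeDerivWithin (Set.Ico 0 T) (fun s y => Literature.MathematicalPhysics.KineticTheory.totalEnergyDensity (ρ s y) (u s y) (θ s y)) t x + Literature.Analysis.FunctionSpaces.Torus.divergence (fun y => (Literature.MathematicalPhysics.KineticTheory.totalEnergyDensity (ρ t y) (u t y) (θ t y) + p (ρ t y) (θ t y)) • u t y) x = 0))) → ∃ η₀ : ℝ, 0 < η₀ ∧ ∀ σ : ℝ, 0 < σ → ∃ p : ℝ → ℝ → ℝ, ContDiffOn ℝ (⊤ : ℕ∞) (fun q : ℝ × ℝ => p q.1 q.2) {q : ℝ × ℝ | 0 < q.1 ∧ q.1 * σ ^ 3 < η₀ ∧ 0 < q.2} ∧ (∀ (ρ₀ θ₀ : Literature.MathematicalPhysics.KineticTheory.T3 → ℝ) (u₀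 : Literature.MathematicalPhysics.KineticTheory.T3 → Literature.MathematicalPhysics.KineticTheory.V3), Literature.Analysis.FunctionSpaces.Torus.IsSmooth ρ₀ → Literature.Analysis.FunctionSpaces.Torus.IsSmooth θ₀ → Literature.Analysis.FunctionSpaces.Torus.IsSmooth u₀ → (∀ x, 0 < ρ₀ x) → (∀ x, 0 < θ₀ x) → (∀ x, ρ₀ x * σ ^ 3 < η₀) → ∃ T : ℝ, 0 < T ∧ ∃ (ρ θ : ℝ → Literature.MathematicalPhysics.KineticTheory.T3 → ℝ) (u : ℝ → Literature.MathematicalPhysics.KineticTheory.T3 → Literature.MathematicalPhysics.KineticTheory.V3), IsSol p T ρ u θ ∧ ρ 0 = ρ₀ ∧ u 0 = u₀ ∧ θ 0 = θ₀) ∧ ∀ (a₀ θ₀ : Literature.MathematicalPhysics.KineticTheory.T3 → ℝ) (u₀ : Literature.MathematicalPhysics.KineticTheory.T3 → Literature.MathematicalPhysics.KineticTheory.V3), Continuous a₀ → Continuous θ₀ → Continuous u₀ → (∀ x, 0 < a₀ x) → (∀ x, 0 < θ₀ x) → ∀ (T : ℝ) (ρ θ : ℝ → Literature.MathematicalPhysics.KineticTheory.T3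 → ℝ) (u : ℝ → Literature.MathematicalPhysics.KineticTheory.T3 → Literature.MathematicalPhysics.KineticTheory.V3), IsSol p T ρ u θ → (∀ t ∈ Set.Ico 0 T, ∀ x, ρ t x * σ ^ 3 < η₀) → ∀ Φ : (N : ℕ) → Literature.Analysis.FluidPDE.HardSphereFlow (Literature.Analysis.FluidPDE.Torus.geometry (Fin 3)) (Literature.MathematicalPhysics.KineticTheory.hsDiameter σ N) (N + 1), (∀ N, MeasureTheory.IsProbabilityMeasure (Literature.MathematicalPhysics.KineticTheory.localGibbsLaw σ a₀ u₀ θ₀ N (Φ N))) → Literature.MathematicalPhysics.KineticTheory.TendstoHydroFieldsAt (fun N => Literature.MathematicalPhysics.KineticTheory.localGibbsLaw σ a₀ u₀ θ₀ N (Φ N)) Φ ρ u θ 0 → ∀ t ∈ Set.Ico 0 T, Literature.MathematicalPhysics.KineticTheory.TendstoHydroFieldsAt (fun N => Literature.MathematicalPhysics.KineticTheory.localGibbsLaw σ a₀ u₀ θ₀ N (Φ N)) Φ ρ u θ t) := by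
  intro h1 h2 IsSol hIsSol
  obtain ⟨η₁, hη₁, H1⟩ := h1 IsSol hIsSol
  obtain ⟨η₂, hη₂, H2⟩ := h2
  refine ⟨min η₁ η₂, lt_min hη₁ hη₂, fun σ hσ => ?_⟩
  obtain ⟨p, hp, hWP, hCONV⟩ := H1 σ hσ
  refine ⟨p, hp.mono ?_, ?_, ?_⟩
  · rintro q ⟨hq1, hq2, hq3⟩
    exact ⟨hq1, lt_of_lt_of_le hq2 (min_le_left _ _), hq3⟩
  · intro ρ₀ θ₀ u₀ hρ hθ hu hρ0 hθ0 hpack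
    exact hWP ρ₀ θ₀ u₀ hρ hθ hu hρ0 hθ0 fun x => lt_of_lt_of_le (hpack x) (min_le_left _ _)
  · intro a₀ θ₀ u₀ ha hθ hu ha0 hθ0 T ρ θ u hsol hguard Φ hprob h0 t ht
    have hguard₁ : ∀ s ∈ Set.Ico 0 T, ∀ x, ρ s x * σ ^ 3 < η₁ :=
      fun s hs x => lt_of_lt_of_le (hguard s hs x) (min_le_left _ _)
    obtain ⟨a, ha_cont, ha_pos, hprob_a, hreal, hent⟩ :=
      hCONV a₀ θ₀ u₀ ha hθ hu ha0 hθ0 T ρ θ u hsol hguard₁ Φ hprob h0 t ht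
    have hcl := (hIsSol p T ρ u θ).mp hsol
    have hρc : Continuous (ρ t) := (hcl.1.isSmooth_slice ht).continuous
    have huc : Continuous (u t) := (hcl.2.1.isSmooth_slice ht).continuous
    have hθc : Continuous (θ t) := (hcl.2.2.1.isSmooth_slice ht).continuous
    have hρpos : ∀ x, 0 < ρ t x := hcl.2.2.2.1 t ht
    have hθpos : ∀ x, 0 < θ t x := hcl.2.2.2.2.1 t ht
    have hguard₂ : ∀ x, ρ t x * σ ^ 3 < η₂ :=
      fun x => lt_of_lt_of_le (hguard t ht x) (min_le_right _ _)
    have hconc := H2 σ hσ a (θ t) (ρ t) (u t) ha_cont hθc hρc huc ha_pos hθpos hρpos hguard₂ Φ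
      hprob_a hreal
    intro χ hχ δ hδ
    obtain ⟨C, hC, hCN⟩ := hconc χ hχ δ hδ
    have hμ : ∀ N, IsProbabilityMeasure ((Φ N).lawAt
        (Literature.MathematicalPhysics.KineticTheory.localGibbsLaw σ a₀ u₀ θ₀ N (Φ N)) t) := fun N => by
      rw [Literature.Analysis.FluidPDE.HardSphereFlow.lawAt_eq]
      exact Measure.isProbabilityMeasure_map ((Φ N).measurable_flow t).aemeasurable
    have key : ∀ P : (N : ℕ) → Literature.Analysis.FluidPDE.Config (N + 1) (Fin 3)
        Literature.MathematicalPhysics.KineticTheory.T3 → Prop,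
        (∀ N, Literature.MathematicalPhysics.KineticTheory.localGibbsLaw σ a (u t) (θ t) N (Φ N) {z | P N z} ≤
          ENNReal.ofReal (C * Real.exp (-(C⁻¹ * (N + 1))))) →
        Tendsto (fun N => Literature.MathematicalPhysics.KineticTheory.localGibbsLaw σ a₀ u₀ θ₀ N (Φ N)
          {z | P N ((Φ N).flow t z)}) atTop (𝓝 0) := by
      intro P hPN
      have hlim := tendsto_measure_of_klDiv_of_expConcentration
        (fun N => (Φ N).lawAt (Literature.MathematicalPhysics.KineticTheory.localGibbsLaw σ a₀ u₀ θ₀ N (Φ N)) t)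
        (fun N => Literature.MathematicalPhysics.KineticTheory.localGibbsLaw σ a (u t) (θ t) N (Φ N)) hμ hprob_a
        (fun N => {z | P N z}) hent hC hPN
      refine tendsto_of_tendsto_of_tendsto_of_le_of_le tendsto_const_nhds hlim (fun N => bot_le)
        fun N => ?_
      show Literature.MathematicalPhysics.KineticTheory.localGibbsLaw σ a₀ u₀ θ₀ N (Φ N)
          ((Φ N).flow t ⁻¹' {z | P N z}) ≤
        ((Φ N).lawAt (Literature.MathematicalPhysics.KineticTheory.localGibbsLaw σ a₀ u₀ θ₀ N (Φ N)) t)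
          {z | P N z}
      rw [Literature.Analysis.FluidPDE.HardSphereFlow.lawAt_eq]
      exact Measure.le_map_apply ((Φ N).measurable_flow t).aemeasurable _
    exact ⟨key (fun N z => δ < |Literature.MathematicalPhysics.KineticTheory.empiricalDensityField z χ -
          ∫ x, χ x * ρ t x|) fun N => (hCN N).1,
      key (fun N z => δ < ‖Literature.MathematicalPhysics.KineticTheory.empiricalMomentumField z χ -
          ∫ x, (χ x * ρ t x) • u t x‖) fun N => (hCN N).2.1,
      key (fun N z => δ < |Literature.MathematicalPhysics.KineticTheory.empiricalEnergyField z χ -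
          ∫ x, χ x * Literature.MathematicalPhysics.KineticTheory.totalEnergyDensity (ρ t x) (u t x) (θ t x)|)
        fun N => (hCN N).2.2⟩


/-! ## Compositions -/

/-- Monotonicity of the exponential budget `C ↦ C e^{-(N+1)/C}`. [folklore] -/
theorem expBudget_mono {C₁ C : ℝ} (hC₁ : 0 < C₁) (h : C₁ ≤ C) (N : ℕ) :
    ENNReal.ofReal (C₁ * Real.exp (-(C₁⁻¹ * (N + 1)))) ≤ ENNReal.ofReal (C * Real.exp (-(C⁻¹ * (N + 1)))) := by
  apply ENNReal.ofReal_le_ofReal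
  have hC : 0 < C := hC₁.trans_le h
  apply mul_le_mul h _ (Real.exp_pos _).le hC.le
  apply Real.exp_le_exp.mpr
  have hn : (0 : ℝ) ≤ (N : ℝ) + 1 := by positivity
  have hinv : C⁻¹ ≤ C₁⁻¹ := inv_anti₀ hC₁ h
  nlinarith [mul_le_mul_of_nonneg_right hinv hn]

/-- Child 2 of the split from stubs 4–5: `LocalGibbsExpConcentration` (statement verbatim), with `C := max C₁ C₂`.
[cite: KipnisLandim1999, Appendix 1 Prop. 8.2] -/
theorem localGibbsExpConcentration_of
    (h4 : ∃ η₀ : ℝ, 0 < η₀ ∧ ∀ σ : ℝ, 0 < σ → ∀ (a θ ρV : Literature.MathematicalPhysics.KineticTheory.T3 → ℝ) (u : Literature.MathematicalPhysics.KineticTheory.T3 → Literature.MathematicalPhysics.KineticTheory.V3), Continuous a → Continuous θ → Continuous ρV → Continuous u → (∀ x, 0 < a x) → (∀ x, 0 < θ x) → (∀ x, 0 < ρV x) → (∀ x, ρV x * σ ^ 3 < η₀) → ∀ Φ : (N : ℕ) → Literature.Analysis.FluidPDE.HardSphereFlow (Literature.Analysis.FluidPDE.Torus.geometry (Fin 3))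 (Literature.MathematicalPhysics.KineticTheory.hsDiameter σ N) (N + 1), (∀ N, MeasureTheory.IsProbabilityMeasure (Literature.MathematicalPhysics.KineticTheory.localGibbsLaw σ a u θ N (Φ N))) → Literature.MathematicalPhysics.KineticTheory.TendstoHydroFieldsAt (fun N => Literature.MathematicalPhysics.KineticTheory.localGibbsLaw σ a u θ N (Φ N)) Φ (fun _ => ρV) (fun _ => u) (fun _ => θ) 0 → ∀ χ : Literature.MathematicalPhysics.KineticTheory.T3 → ℝ, Continuous χ → ∀ δ : ℝ, 0 < δ → ∃ C : ℝ, 0 < C ∧ ∀ N : ℕ, Literature.MathematicalPhysics.KineticTheory.localGibbsLaw σ a u θ N (Φ N) {z | δ < |Literature.MathematicalPhysics.KineticTheory.empiricalDensityField z χ - ∫ x, χ x * ρV x|} ≤ ENNReal.ofReal (C * Real.exp (-(C⁻¹ * (N + 1)))))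
    (h5 : ∀ σ : ℝ, 0 < σ → ∀ (a θ ρV : Literature.MathematicalPhysics.KineticTheory.T3 → ℝ) (u : Literature.MathematicalPhysics.KineticTheory.T3 → Literature.MathematicalPhysics.KineticTheory.V3), Continuous a → Continuous θ → Continuous ρV → Continuous u → (∀ x, 0 < a x) → (∀ x, 0 < θ x) → ∀ Φ : (N : ℕ) → Literature.Analysis.FluidPDE.HardSphereFlow (Literature.Analysis.FluidPDE.Torus.geometry (Fin 3)) (Literature.MathematicalPhysics.KineticTheory.hsDiameter σ N) (N + 1), (∀ N, MeasureTheory.IsProbabilityMeasure (Literature.MathematicalPhysics.KineticTheory.localGibbsLaw σ a u θ N (Φ N))) → (∀ χ : Literature.MathematicalPhysics.KineticTheory.T3 → ℝ, Continuous χ → ∀ δ : ℝ, 0 < δ → ∃ C : ℝ, 0 < C ∧ ∀ N : ℕ, Literature.MathematicalPhysics.KineticTheory.localGibbsLaw σ a u θ N (Φ N) {z | δ < |Literature.MathematicalPhysics.KineticTheory.empiricalDensityField z χ - ∫ x, χ x * ρV x|} ≤ ENNReal.ofReal (C * Real.exp (-(C⁻¹ * (N + 1))))) → ∀ χ : Literature.MathematicalPhysics.KineticTheory.T3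 → ℝ, Continuous χ → ∀ δ : ℝ, 0 < δ → ∃ C : ℝ, 0 < C ∧ ∀ N : ℕ, Literature.MathematicalPhysics.KineticTheory.localGibbsLaw σ a u θ N (Φ N) {z | δ < ‖Literature.MathematicalPhysics.KineticTheory.empiricalMomentumField z χ - ∫ x, (χ x * ρV x) • u x‖} ≤ ENNReal.ofReal (C * Real.exp (-(C⁻¹ * (N + 1)))) ∧ Literature.MathematicalPhysics.KineticTheory.localGibbsLaw σ a u θ N (Φ N) {z | δ < |Literature.MathematicalPhysics.KineticTheory.empiricalEnergyField z χ - ∫ x, χ x * Literature.MathematicalPhysics.KineticTheory.totalEnergyDensity (ρV x) (u x) (θ x)|} ≤ ENNReal.ofReal (C * Real.exp (-(C⁻¹ * (N + 1))))) :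
    ∃ η₀ : ℝ, 0 < η₀ ∧ ∀ σ : ℝ, 0 < σ → ∀ (a θ ρV : Literature.MathematicalPhysics.KineticTheory.T3 → ℝ) (u : Literature.MathematicalPhysics.KineticTheory.T3 → Literature.MathematicalPhysics.KineticTheory.V3), Continuous a → Continuous θ → Continuous ρV → Continuous u → (∀ x, 0 < a x) → (∀ x, 0 < θ x) → (∀ x, 0 < ρV x) → (∀ x, ρV x * σ ^ 3 < η₀) → ∀ Φ : (N : ℕ) → Literature.Analysis.FluidPDE.HardSphereFlow (Literature.Analysis.FluidPDE.Torus.geometry (Fin 3)) (Literature.MathematicalPhysics.KineticTheory.hsDiameter σ N) (N + 1), (∀ N, MeasureTheory.IsProbabilityMeasure (Literature.MathematicalPhysics.KineticTheory.localGibbsLaw σ a u θ N (Φ N))) → Literature.MathematicalPhysics.KineticTheory.TendstoHydroFieldsAt (fun N => Literature.MathematicalPhysics.KineticTheory.localGibbsLaw σ a u θ N (Φ N)) Φ (fun _ => ρV) (fun _ => u) (fun _ => θ) 0 → ∀ χ : Literature.MathematicalPhysics.KineticTheory.T3 → ℝ, Continuous χ → ∀ δ : ℝ, 0 < δ → ∃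 C : ℝ, 0 < C ∧ ∀ N : ℕ, Literature.MathematicalPhysics.KineticTheory.localGibbsLaw σ a u θ N (Φ N) {z | δ < |Literature.MathematicalPhysics.KineticTheory.empiricalDensityField z χ - ∫ x, χ x * ρV x|} ≤ ENNReal.ofReal (C * Real.exp (-(C⁻¹ * (N + 1)))) ∧ Literature.MathematicalPhysics.KineticTheory.localGibbsLaw σ a u θ N (Φ N) {z | δ < ‖Literature.MathematicalPhysics.KineticTheory.empiricalMomentumField z χ - ∫ x, (χ x * ρV x) • u x‖} ≤ ENNReal.ofReal (C * Real.exp (-(C⁻¹ * (N + 1)))) ∧ Literature.MathematicalPhysics.KineticTheory.localGibbsLaw σ a u θ N (Φ N) {z | δ < |Literature.MathematicalPhysics.KineticTheory.empiricalEnergyField z χ - ∫ x, χ x * Literature.MathematicalPhysics.KineticTheory.totalEnergyDensity (ρV x) (u x) (θ x)|} ≤ ENNReal.ofReal (C * Real.exp (-(C⁻¹ * (N + 1)))) := by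
  obtain ⟨η₀, hη₀, H4⟩ := h4
  refine ⟨η₀, hη₀, fun σ hσ a θ ρV u ha hθ hρ hu ha0 hθ0 hρ0 hguard Φ hprob hlln χ hχ δ hδ => ?_⟩
  have hdens := H4 σ hσ a θ ρV u ha hθ hρ hu ha0 hθ0 hρ0 hguard Φ hprob hlln
  obtain ⟨C₁, hC₁, h1⟩ := hdens χ hχ δ hδ
  obtain ⟨C₂, hC₂, h2⟩ := h5 σ hσ a θ ρV u ha hθ hρ hu ha0 hθ0 Φ hprob hdens χ hχ δ hδ
  refine ⟨max C₁ C₂, lt_max_of_lt_left hC₁, fun N => ⟨?_, ?_, ?_⟩⟩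
  · exact (h1 N).trans (expBudget_mono hC₁ (le_max_left _ _) N)
  · exact (h2 N).1.trans (expBudget_mono hC₂ (le_max_right _ _) N)
  · exact (h2 N).2.trans (expBudget_mono hC₂ (le_max_right _ _) N)

/-- Child 1 of the split from stubs 1–3: `EntropicClosure` (statement verbatim), with `p̃ := hsPressure σ` and the
threshold `min η₁ (min η₂ η₃)`; the bound predicate `IsSol` at `p = hsPressure σ` is `IsHardSphereEulerSolution σ`
(the eight clauses are its eight fields). [cite: OllaVaradhanYau1993, Thm 2.1] -/
theorem entropicClosure_of
    (h1 : ∃ η₁ : ℝ, 0 < η₁ ∧ ∀ σ : ℝ, 0 < σ → ContDiffOn ℝ (⊤ : ℕ∞) (fun q : ℝ × ℝ => Literature.MathematicalPhysics.KineticTheory.hsPressure σ q.1 q.2) {q : ℝ × ℝ | 0 < q.1 ∧ q.1 * σ ^ 3 < η₁ ∧ 0 < q.2} ∧ ∀ (ρ₀ θ₀ : Literature.MathematicalPhysics.KineticTheory.T3 → ℝ) (u₀ : Literature.MathematicalPhysics.KineticTheory.T3 → Literature.MathematicalPhysics.KineticTheory.V3), Literature.Analysis.FunctionSpaces.Torus.IsSmooth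 ρ₀ → Literature.Analysis.FunctionSpaces.Torus.IsSmooth θ₀ → Literature.Analysis.FunctionSpaces.Torus.IsSmooth u₀ → (∀ x, 0 < ρ₀ x) → (∀ x, 0 < θ₀ x) → (∀ x, ρ₀ x * σ ^ 3 < η₁) → ∃ T : ℝ, 0 < T ∧ ∃ (ρ θ : ℝ → Literature.MathematicalPhysics.KineticTheory.T3 → ℝ) (u : ℝ → Literature.MathematicalPhysics.KineticTheory.T3 → Literature.MathematicalPhysics.KineticTheory.V3), Literature.MathematicalPhysics.KineticTheory.IsHardSphereEulerSolution σ T ρ u θ ∧ ρ 0 = ρ₀ ∧ u 0 = u₀ ∧ θ 0 = θ₀)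
    (h2 : ∃ η₂ : ℝ, 0 < η₂ ∧ ∀ σ : ℝ, 0 < σ → ∀ (a₀ θ₀ : Literature.MathematicalPhysics.KineticTheory.T3 → ℝ) (u₀ : Literature.MathematicalPhysics.KineticTheory.T3 → Literature.MathematicalPhysics.KineticTheory.V3), Continuous a₀ → Continuous θ₀ → Continuous u₀ → (∀ x, 0 < a₀ x) → (∀ x, 0 < θ₀ x) → ∀ (T : ℝ) (ρ θ : ℝ → Literature.MathematicalPhysics.KineticTheory.T3 → ℝ) (u : ℝ → Literature.MathematicalPhysics.KineticTheory.T3 → Literature.MathematicalPhysics.KineticTheory.V3), Literature.MathematicalPhysics.KineticTheory.IsHardSphereEulerSolution σ T ρ u θ → (∀ t ∈ Set.Ico 0 T, ∀ x, ρ t x * σ ^ 3 < η₂) → ∀ Φ : (N : ℕ) → Literature.Analysis.FluidPDE.HardSphereFlow (Literature.Analysis.FluidPDE.Torus.geometry (Fin 3)) (Literature.MathematicalPhysics.KineticTheory.hsDiameter σ N) (N + 1), (∀ N, MeasureTheory.IsProbabilityMeasure (Literature.MathematicalPhysics.KineticTheory.localGibbsLaw σ a₀ u₀ θ₀ N (Φ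 N))) → Literature.MathematicalPhysics.KineticTheory.TendstoHydroFieldsAt (fun N => Literature.MathematicalPhysics.KineticTheory.localGibbsLaw σ a₀ u₀ θ₀ N (Φ N)) Φ ρ u θ 0 → ∀ t ∈ Set.Ico 0 T, ∃ a : Literature.MathematicalPhysics.KineticTheory.T3 → ℝ, Continuous a ∧ (∀ x, 0 < a x) ∧ (∀ N, MeasureTheory.IsProbabilityMeasure (Literature.MathematicalPhysics.KineticTheory.localGibbsLaw σ a (u t) (θ t) N (Φ N))) ∧ Literature.MathematicalPhysics.KineticTheory.TendstoHydroFieldsAt (fun N => Literature.MathematicalPhysics.KineticTheory.localGibbsLaw σ a (u t) (θ t) N (Φ N)) Φ (fun _ => ρ t) (fun _ => u t) (fun _ => θ t) 0)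
    (h3 : ∃ η₃ : ℝ, 0 < η₃ ∧ ∀ σ : ℝ, 0 < σ → ∀ (a₀ θ₀ : Literature.MathematicalPhysics.KineticTheory.T3 → ℝ) (u₀ : Literature.MathematicalPhysics.KineticTheory.T3 → Literature.MathematicalPhysics.KineticTheory.V3), Continuous a₀ → Continuous θ₀ → Continuous u₀ → (∀ x, 0 < a₀ x) → (∀ x, 0 < θ₀ x) → ∀ (T : ℝ) (ρ θ : ℝ → Literature.MathematicalPhysics.KineticTheory.T3 → ℝ) (u : ℝ → Literature.MathematicalPhysics.KineticTheory.T3 → Literature.MathematicalPhysics.KineticTheory.V3), Literature.MathematicalPhysics.KineticTheory.IsHardSphereEulerSolution σ T ρ u θ → (∀ t ∈ Set.Ico 0 T, ∀ x, ρ t x * σ ^ 3 < η₃) → ∀ Φ : (N : ℕ) → Literature.Analysis.FluidPDE.HardSphereFlow (Literature.Analysis.FluidPDE.Torus.geometry (Fin 3)) (Literature.MathematicalPhysics.KineticTheory.hsDiameter σ N) (N + 1), (∀ N, MeasureTheory.IsProbabilityMeasure (Literature.MathematicalPhysics.KineticTheory.localGibbsLaw σ a₀ u₀ θ₀ N (Φ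 N))) → Literature.MathematicalPhysics.KineticTheory.TendstoHydroFieldsAt (fun N => Literature.MathematicalPhysics.KineticTheory.localGibbsLaw σ a₀ u₀ θ₀ N (Φ N)) Φ ρ u θ 0 → ∀ t ∈ Set.Ico 0 T, ∀ a : Literature.MathematicalPhysics.KineticTheory.T3 → ℝ, Continuous a → (∀ x, 0 < a x) → (∀ N, MeasureTheory.IsProbabilityMeasure (Literature.MathematicalPhysics.KineticTheory.localGibbsLaw σ a (u t) (θ t) N (Φ N))) → Literature.MathematicalPhysics.KineticTheory.TendstoHydroFieldsAt (fun N => Literature.MathematicalPhysics.KineticTheory.localGibbsLaw σ a (u t) (θ t) N (Φ N)) Φ (fun _ => ρ t) (fun _ => u t) (fun _ => θ t) 0 → Filter.Tendsto (fun N : ℕ => InformationTheory.klDiv ((Φ N).lawAt (Literature.MathematicalPhysics.KineticTheory.localGibbsLaw σ a₀ u₀ θ₀ N (Φ N)) t) (Literature.MathematicalPhysics.KineticTheory.localGibbsLaw σ a (u t) (θ t) N (Φ N)) / ((N : ENNReal) + 1)) Filter.atTop (nhds 0)) :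
    ∀ IsSol : (ℝ → ℝ → ℝ) → ℝ → (ℝ → Literature.MathematicalPhysics.KineticTheory.T3 → ℝ) → (ℝ → Literature.MathematicalPhysics.KineticTheory.T3 → Literature.MathematicalPhysics.KineticTheory.V3) → (ℝ → Literature.MathematicalPhysics.KineticTheory.T3 → ℝ) → Prop, (∀ p T ρ u θ, IsSol p T ρ u θ ↔ (Literature.Analysis.FunctionSpaces.Torus.IsSmoothSpaceTimeOn (Set.Ico 0 T) ρ ∧ Literature.Analysis.FunctionSpaces.Torus.IsSmoothSpaceTimeOn (Set.Ico 0 T) u ∧ Literature.Analysis.FunctionSpaces.Torus.IsSmoothSpaceTimeOn (Set.Ico 0 T) θ ∧ (∀ t ∈ Set.Ico 0 T, ∀ x, 0 < ρ t x) ∧ (∀ t ∈ Set.Ico 0 T, ∀ x, 0 < θ t x) ∧ (∀ t ∈ Set.Ico 0 T, ∀ x, Literature.Analysis.FunctionSpaces.Torus.timeDerivWithin (Set.Ico 0 T) ρ t x + Literature.Analysis.FunctionSpaces.Torus.divergence (fun y => ρ t y • u t y) x = 0) ∧ (∀ t ∈ Set.Ico 0 T, ∀ x, Literature.Analysis.FunctionSpaces.Torus.timeDerivWithin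 (Set.Ico 0 T) (fun s y => ρ s y • u s y) t x + (∑ i, Literature.Analysis.FunctionSpaces.Torus.partialDeriv i (fun y => (ρ t y * u t y i) • u t y) x) + Literature.Analysis.FunctionSpaces.Torus.gradient (fun y => p (ρ t y) (θ t y)) x = 0) ∧ (∀ t ∈ Set.Ico 0 T, ∀ x, Literature.Analysis.FunctionSpaces.Torus.timeDerivWithin (Set.Ico 0 T) (fun s y => Literature.MathematicalPhysics.KineticTheory.totalEnergyDensity (ρ s y) (u s y) (θ s y)) t x + Literature.Analysis.FunctionSpaces.Torus.divergence (fun y => (Literature.MathematicalPhysics.KineticTheory.totalEnergyDensity (ρ t y) (u t y) (θ t y) + p (ρ t y) (θ t y)) • u t y) x = 0))) → ∃ η₀ : ℝ, 0 < η₀ ∧ ∀ σ : ℝ, 0 < σ → ∃ p : ℝ → ℝ → ℝ, ContDiffOn ℝ (⊤ : ℕ∞) (fun q : ℝ × ℝ => p q.1 q.2) {q : ℝ × ℝ | 0 < q.1 ∧ q.1 * σ ^ 3 < η₀ ∧ 0 < q.2} ∧ (∀ (ρ₀ θ₀ : Literature.MathematicalPhysics.KineticTheory.T3 → ℝ) (u₀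 : Literature.MathematicalPhysics.KineticTheory.T3 → Literature.MathematicalPhysics.KineticTheory.V3), Literature.Analysis.FunctionSpaces.Torus.IsSmooth ρ₀ → Literature.Analysis.FunctionSpaces.Torus.IsSmooth θ₀ → Literature.Analysis.FunctionSpaces.Torus.IsSmooth u₀ → (∀ x, 0 < ρ₀ x) → (∀ x, 0 < θ₀ x) → (∀ x, ρ₀ x * σ ^ 3 < η₀) → ∃ T : ℝ, 0 < T ∧ ∃ (ρ θ : ℝ → Literature.MathematicalPhysics.KineticTheory.T3 → ℝ) (u : ℝ → Literature.MathematicalPhysics.KineticTheory.T3 → Literature.MathematicalPhysics.KineticTheory.V3), IsSol p T ρ u θ ∧ ρ 0 = ρ₀ ∧ u 0 = u₀ ∧ θ 0 = θ₀) ∧ ∀ (a₀ θ₀ : Literature.MathematicalPhysics.KineticTheory.T3 → ℝ) (u₀ : Literature.MathematicalPhysics.KineticTheory.T3 → Literature.MathematicalPhysics.KineticTheory.V3), Continuous a₀ → Continuous θ₀ → Continuous u₀ → (∀ x, 0 < a₀ x) → (∀ x, 0 < θ₀ x) → ∀ (T : ℝ) (ρ θ : ℝ → Literature.MathematicalPhysics.KineticTheory.T3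 → ℝ) (u : ℝ → Literature.MathematicalPhysics.KineticTheory.T3 → Literature.MathematicalPhysics.KineticTheory.V3), IsSol p T ρ u θ → (∀ t ∈ Set.Ico 0 T, ∀ x, ρ t x * σ ^ 3 < η₀) → ∀ Φ : (N : ℕ) → Literature.Analysis.FluidPDE.HardSphereFlow (Literature.Analysis.FluidPDE.Torus.geometry (Fin 3)) (Literature.MathematicalPhysics.KineticTheory.hsDiameter σ N) (N + 1), (∀ N, MeasureTheory.IsProbabilityMeasure (Literature.MathematicalPhysics.KineticTheory.localGibbsLaw σ a₀ u₀ θ₀ N (Φ N))) → Literature.MathematicalPhysics.KineticTheory.TendstoHydroFieldsAt (fun N => Literature.MathematicalPhysics.KineticTheory.localGibbsLaw σ a₀ u₀ θ₀ N (Φ N)) Φ ρ u θ 0 → ∀ t ∈ Set.Ico 0 T, ∃ a : Literature.MathematicalPhysics.KineticTheory.T3 → ℝ, Continuous a ∧ (∀ x, 0 < a x) ∧ (∀ N, MeasureTheory.IsProbabilityMeasure (Literature.MathematicalPhysics.KineticTheory.localGibbsLaw σ a (u t) (θ t) N (Φ N))) ∧ Literature.MathematicalPhysics.KineticTheory.TendstoHydroFieldsAt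 (fun N => Literature.MathematicalPhysics.KineticTheory.localGibbsLaw σ a (u t) (θ t) N (Φ N)) Φ (fun _ => ρ t) (fun _ => u t) (fun _ => θ t) 0 ∧ Filter.Tendsto (fun N : ℕ => InformationTheory.klDiv ((Φ N).lawAt (Literature.MathematicalPhysics.KineticTheory.localGibbsLaw σ a₀ u₀ θ₀ N (Φ N)) t) (Literature.MathematicalPhysics.KineticTheory.localGibbsLaw σ a (u t) (θ t) N (Φ N)) / ((N : ENNReal) + 1)) Filter.atTop (nhds 0) := by
  intro IsSol hIsSol
  obtain ⟨η₁, hη₁, H1⟩ := h1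
  obtain ⟨η₂, hη₂, H2⟩ := h2
  obtain ⟨η₃, hη₃, H3⟩ := h3
  refine ⟨min η₁ (min η₂ η₃), lt_min hη₁ (lt_min hη₂ hη₃), fun σ hσ => ?_⟩
  obtain ⟨hsmooth, hWP⟩ := H1 σ hσ
  have hiff : ∀ (T : ℝ) (ρ θ : ℝ → Literature.MathematicalPhysics.KineticTheory.T3 → ℝ)
      (u : ℝ → Literature.MathematicalPhysics.KineticTheory.T3 → Literature.MathematicalPhysics.KineticTheory.V3),
      IsSol (Literature.MathematicalPhysics.KineticTheory.hsPressure σ) T ρ u θ ↔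
        Literature.MathematicalPhysics.KineticTheory.IsHardSphereEulerSolution σ T ρ u θ := fun T ρ θ u =>
    (hIsSol _ T ρ u θ).trans
      ⟨fun h => ⟨h.1, h.2.1, h.2.2.1, h.2.2.2.1, h.2.2.2.2.1, h.2.2.2.2.2.1, h.2.2.2.2.2.2.1, h.2.2.2.2.2.2.2⟩,
        fun h => ⟨h.smooth_density, h.smooth_velocity, h.smooth_temperature, h.density_pos, h.temperature_pos,
          h.mass, h.momentum, h.energy⟩⟩
  refine ⟨Literature.MathematicalPhysics.KineticTheory.hsPressure σ, hsmooth.mono ?_, ?_, ?_⟩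
  · rintro q ⟨hq1, hq2, hq3⟩
    exact ⟨hq1, lt_of_lt_of_le hq2 (min_le_left _ _), hq3⟩
  · intro ρ₀ θ₀ u₀ hρ hθ hu hρ0 hθ0 hpack
    obtain ⟨T, hT, ρ, θ, u, hsol, h0⟩ :=
      hWP ρ₀ θ₀ u₀ hρ hθ hu hρ0 hθ0 fun x => lt_of_lt_of_le (hpack x) (min_le_left _ _)
    exact ⟨T, hT, ρ, θ, u, (hiff T ρ θ u).mpr hsol, h0⟩
  · intro a₀ θ₀ u₀ ha hθ hu ha0 hθ0 T ρ θ u hsol hguard Φ hprob hlln t ht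
    have hsol' := (hiff T ρ θ u).mp hsol
    have hg₂ : ∀ s ∈ Set.Ico 0 T, ∀ x, ρ s x * σ ^ 3 < η₂ := fun s hs x =>
      lt_of_lt_of_le (hguard s hs x) ((min_le_right _ _).trans (min_le_left _ _))
    have hg₃ : ∀ s ∈ Set.Ico 0 T, ∀ x, ρ s x * σ ^ 3 < η₃ := fun s hs x =>
      lt_of_lt_of_le (hguard s hs x) ((min_le_right _ _).trans (min_le_right _ _))
    obtain ⟨a, hac, hap, hprob_a, hreal⟩ :=
      H2 σ hσ a₀ θ₀ u₀ ha hθ hu ha0 hθ0 T ρ θ u hsol' hg₂ Φ hprob hlln t ht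
    exact ⟨a, hac, hap, hprob_a, hreal,
      H3 σ hσ a₀ θ₀ u₀ ha hθ hu ha0 hθ0 T ρ θ u hsol' hg₃ Φ hprob hlln t ht a hac hap hprob_a hreal⟩

/-- **The composition of the line** (registered skeleton): the crux BY NAME from the five stubs —
`EntropicClosure` from stubs 1–3 (`entropicClosure_of`), `LocalGibbsExpConcentration` from stubs 4–5
(`localGibbsExpConcentration_of`), then the split glue `autonomousClosure_of_subs` (stated in this file with the crux
unfolded, so that this theorem is the only one concluding the crux by name). Its only `sorry`s are the five stubs.
[cite: KipnisLandim1999, Appendix 1 Prop. 8.2] -/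
theorem AutonomousClosure_of :
    Summit.AtomisticToContinuum.HydrodynamicLimit.Theses.LoschmidtIsentropicSelection.AutonomousClosure :=
  autonomousClosure_of_subs
    (entropicClosure_of stub_hsLawWP stub_sliceRealisability stub_entropyPropagation)
    (localGibbsExpConcentration_of stub_densityLDP stub_maxwellianMarks)

end Summit.AtomisticToContinuum.HydrodynamicLimit.Cruxes.AutonomousClosure.EntropySeam
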